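import Literature.MathematicalPhysics.QuantumFieldTheory.Balaban1983to89.B8SockHFP59
import Literature.MathematicalPhysics.QuantumFieldTheory.Balaban1983to89.B8Prop3KLevelBdry
import Literature.MathematicalPhysics.QuantumFieldTheory.Balaban1983to89.B8Ineq159FlatMaps
import Literature.MathematicalPhysics.QuantumFieldTheory.Balaban1983to89.B9SupplySockB9P3ZdBeta

/-!
# `Balaban1983to89.B8SockHFP59BdryBeta` — [Balaban1985RegularSpaces] PROPOSITION 5's fixed point for the level-`m` datum of Theorem 4 fed by
# THEOREM 4's OWN (1.59)-CLAUSE IN EDITION β (averaging datum `|B₁|β` over `Λb ∪ {level-0 crossing bonds of Ω₀}`, exterior-collar term)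

statement-level skeleton of published theorems with citation tags; proofs where landed; nothing here is a claim about the
Yang–Mills mass gap

PDF held: `paper:balaban1985-cmp99-regular-spaces-gauge-fixing`; pp. 77, 81–83, 86–89, 92–94.

CITATION HEADER (lean-in-tree rule).  Cell `pub-ymgap` (HUMAN RULING D-0062, Track A), DAG node N05 = [B8], seat `pub-ymgap-dag-n05-e` g8 (R141 (C)
row s3b — the FLAT LINE re-keyed to the socket of record).  WHY: g7's `B8SockHFP59Bdry` (p527776) feeds Proposition 5's step from Theorem 4's (1.59) clause
in the currency R-d (`|B₁|` over the constraint bonds only) — refuted at a finite region by the boundary pure-gauge mode (dag-n06-b CANDIDATE-3, p539131).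
EDITION β (dag-lead RULING №189 (2); dag-n06-b p541339) puts the level-0 crossing bonds into `|B₁|`.  THIS FILE re-runs p527776 in β: ★
`grad_bound_of_datum59_bdryβ` ((1.69) from the two β members — Proposition 3 assembled inline with the crossing terms of `|B₁|β` bounded by `2α₁` via
`u₁ = 1` at both end-points of a crossing bond: support clause + the DISPLAYED boundary-layer law + (1.29)₀, then (1.66)₀), ★ `sockHFP_body_of_join_59_bdryβ`
(the ∃λ-body with `H59Dβm`).  Kind «kernel-checked proof», theorems only, no `def`.

HONEST SCOPE.  (i) `H59Dβm` is a HYPOTHESIS ([4] Thm 3.3 for `G(U₀)` on a finite region WITH exterior data in the β reading; dag-n06-b's member supplier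
is A6-witnessed at truncation 0 only).  A6-PARTIAL: the boundary pure-gauge mode (`J = 0`, `Φ₀ = 0`, `|B₁|β = ηt`) makes the β clause FALSE below an
absolute threshold in `B₀` (as in print, `B₀` = [4] Thm 3.3's constant); the theorems hold for every `B₀`, their clause vacuous below the threshold (declared) (ref-E g10 READ-12, STATUS S.13159, on p544795: for the two-line body the kernel threshold is `B₀ ≥ 1` at every cube member with `k ≥ 1` — certificate `RefE.G10.BdryBetaA6.beta_socket_false_of_B₀_lt_one`, evidence only).
(ii) The [4] letters and their laws, the JOIN's windows, `B_∂`, `4B_∂ ≤ (dL − 1)B₀`, `hlay` are displayed hypotheses ∕ the tree's bookkeeping.  Count-neutral;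
N05 NOT discharged; one finite `𝕋⁴` programme at fixed `ε`, Bałaban as printed; nothing continuum ∕ ℝ⁴ ∕ OS ∕ mass-gap ∕ Clay.  No `sorry`, no `def`, no
`instance`, no `notation`.  Unit `pub-ymgap-dag-n05-e` (g8), 2026-08-27.
-/

noncomputable section

open NormedSpace
open scoped BigOperators

namespace Literature.MathematicalPhysics.QuantumFieldTheory.Balaban1983to89.B8SockHFP59BdryBeta

open Complex (I)
open B7Prop1Explicit B7Prop2Explicit B7Prop1Local B7Eq92Concrete
open B7Prop2Explicit (C0 c2')
open B7Prop3Flat (c3)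
open B7Prop10General (C6 C4G)
open B7Prop9Flat (C5')
open B7Eq78Linearization (conjR zdBlocking QprimeIter)
open B8Ineq132 (covDerivFwd covDeriv InAk BondTouches)
open B8Eq119TwistedAxial (Restr129 InAx bgT)
open B8Eq184Proof (gaugeExp cfgExp)
open B8Eq182Proof (gAd)
open B8Eq188Proof (frakF3)
open B8Lemma1NonAbelian (mulCfg)
open B8Eq140Level (SideTouches sideTouches_mono)
open B8Eq146AExpansion (iEta expCfg)
open B8Ineq130 (tlo thi)
open B8Thm2LogB (blockTop)
open B8Eq138LandauZd (IsLandau138W covDivB covLap QT logCfg)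
open B8Ineq159FlatMaps (logCfg_eq_of_cfgExp)
open B8Ineq125Concrete (C2p)
open B8Eq1117Concrete (XSpace)
open B7Prop4GeneralLevels (logCovIter linCovIter)
open B8Eq155JBound (Jcur wsup expCfg_iEta_mem_unitaryUnits)
open B8ScaledSupNorm (bondNorm msup weight Bdd)
open B8Prop3GaugeFixedKLevel (expCfg_iEta_eq_cfgExp mem_unitaryUnits_of_mgauge_eq mulCfg_eq_gaugeAct_of_mgauge_eq
  inAk_congr_of_sideTouches)
open B8Prop5ContractionKLevel (Bd2 Mc Kc)
open B8LambdaSpaceKLevel (wt)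
open B8Prop5SocketDatum (exists_masked_datum grad_bound_trivial bd2_covDivB_of_grad
  restr129_succ_of_truncation sideTouches_pair_of_mem sideTouches_of_tower_bond h33_of_inAk hP_of_datum h69_of_datum hA_of_datum)
open B8Prop5JoinSectELocalRD (hFP_kLevel_of_sectE_local'_RD)
open B8SockHFPAssembly (isSelfAdjoint_covDivB covDivB_congr_at frakF3_congr_at inAx_mgauge_expCfg_of_datum)
open QuantumLattice (blockSites)

-- `Site` alone could resolve to the torus sites of `Setup.lean`; re-export the `ℤ^d` sites of `B7Prop1Explicit`.
export B7Prop1Explicit (Site)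

variable {d : ℕ}
open B9SupplySockB9P3ZdBeta (CrossB)

/-! ## §1 (1.69) from (1.67)–(1.68) by Proposition 3 at level `m`, the TWO (1.59) members of the datum in EDITION β -/
section Grad

variable {𝔸 : Type*} [CStarAlgebra 𝔸] [Nontrivial 𝔸]

/-- ★ **(1.69) FROM (1.67)–(1.68) BY PROPOSITION 3 AT LEVEL `m ≥ 1`, THE (1.59) INPUT AS TWO MEMBERS FOR THE DATUM IN EDITION β** — g7's
`B8SockHFP59Bdry.grad_bound_of_datum59_bdry` with the two (1.59) members `h59a`, `h59g` carrying the β averaging datum `|B₁|β` (constraint bonds ∪ level-0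
crossing bonds of `Ω₀`; the body of dag-n06-b's `SockB9P3D4β` at the datum) and ONE displayed law `hlay` (boundary-layer sites of `Ω₀` lie in `Λs m 0`).  SAME
conclusion `(Lʲη)²|(∇^η_{U₀,κ}A′_τ)(y)| ≤ 5dLB₀(α₀ + α₁)`.  PROOF: as there, except that Proposition 3 is assembled inline (`eq155_norm_kLevel_hermitian`,
`apriori_160_bdry`, `apriori_162_bdry`) with «|B₁|β < 2dLα₁ + C₂α₂²» proved pointwise: on the constraint bonds by (1.42) + (1.37) (`norm_B1_lt_kLevel`), on a
crossing bond `Q₀ = 1` and `u₁ = 1` at both end-points (support clause outside, `hlay` + (1.29)₀ inside), so `U₁ = U′` there and the term is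
`η‖A′(b)‖ ≤ 2‖U′(b) − 1‖ ≤ 2α₁ ≤ 2dLα₁` by (1.66)₀ — same constant, no new window.
[cite: Balaban1985RegularSpaces, (1.66)–(1.69) p.88, Prop. 3 p.87, (1.40)–(1.42) p.83, (1.58)–(1.62) pp.86–87, (1.29) p.81, (1.31) p.82, Prop. 5 p.94, p.77] -/
theorem grad_bound_of_datum59_bdryβ (hd2 : 2 ≤ d) {η : ℝ} (hη : 0 < η) {L : ℕ} (hL : 2 ≤ L) (K : ℕ)
    {U₀ U' : Site d → Fin d → 𝔸ˣ} (hU₀ : ∀ x κ, U₀ x κ ∈ unitaryUnits 𝔸) (hU' : ∀ x κ, U' x κ ∈ unitaryUnits 𝔸)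
    {α₀ α₁ α₂ B₀ C₂ : ℝ} (hα₀ : 0 < α₀) (hα₁ : 0 < α₁) (hα₂ : 0 < α₂) (hB₀ : 0 ≤ B₀)
    -- Prop. 3's windows at `(α₀, α₂)` (cf. `B8LeafModelZd3.prop3_windows`), (1.61), and `dLα₁ ≤ 1/8`
    (hα3 : C0 d * α₀ ≤ 1 / 3) (hα4 : 4 * α₀ ≤ c2' d L) (h16 : 16 * α₂ ≤ 1) (hd5 : 5 * α₂ * ((d : ℝ) - 1) ≤ 4)
    (hsmall : Real.exp (4 * (800 * ((d : ℝ) + 1) ^ 2 * ((d : ℝ) + 4)) * α₀) * (1 + 8 * (131072 * ((d : ℝ) + 1) ^ 2) * α₂) ≤ 2)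
    (hc₃ : 2 * α₂ ≤ c3 d L) (hside : 36 * d * B₀ * α₂ ≤ 1 / 2) (h50 : 50 * d * α₂ ≤ 1)
    (hC₂ : 8 * (131072 * ((d : ℝ) + 1) ^ 2) * Real.exp (4 * (800 * ((d : ℝ) + 1) ^ 2 * ((d : ℝ) + 4)) * α₀) ≤ C₂)
    (h61 : 2 * α₂ ^ 2 + 20 * d * α₀ * α₂ + 2 * C₂ * α₂ ^ 2 ≤ α₀ + α₁) (hsmall₁ : (d : ℝ) * L * α₁ ≤ 1 / 8)
    -- the member's geometry
    (Ω : ℕ → Set (Site d)) (hΩ : ∀ j, Ω (j + 1) ⊆ Ω j) (Λs : ℕ → ℕ → Set (Site d)) (Λb : ℕ → ℕ → Set (Site d × Fin d))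
    (hbox : ∀ m, m ≤ K → ∀ j, j ≤ m → ∀ c ∈ Λb m j, ∀ x, InBox (loK L j c.1) (bondHiK L j c.1 c.2) x → x ∈ Ω j)
    (hclass : ∀ m, m ≤ K → ∀ j, j ≤ m → ∀ c ∈ Λb m j,
      (c.1 ∈ Λs m j ∧ c.1 + e c.2 ∈ Λs m j) ∨
      (∃ j', j = j' + 1 ∧ (∀ x, (L : ℤ) • c.1 ≤ x → x ≤ (L : ℤ) • c.1 + blockTop L → x ∈ Λs m j') ∧ c.1 + e c.2 ∈ Λs m j) ∨
      (∃ j', j = j' + 1 ∧ c.1 ∈ Λs m j ∧ (∀ x, (L : ℤ) • (c.1 + e c.2) ≤ x → x ≤ (L : ℤ) • (c.1 + e c.2) + blockTop L → x ∈ Λs m j')))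
    -- the socket's antecedents: (1.33), (1.34), (1.35)/(1.66)
    (h33 : InAk L K η α₀ Ω U₀) (h34 : InAk L K η α₀ Ω (mulCfg U' U₀)) (hAx : ∀ m, m ≤ K → InAx L m (Λs m) U₀ (mulCfg U' U₀))
    (h135 : ∀ j, j ≤ K → ∀ (z : Site d) (μ : Fin d), (∀ x, InBox (loK L j z) (bondHiK L j z μ) x → x ∈ Ω j) →
      ‖(avgIter L (mulCfg U' U₀) j z μ : 𝔸) - (avgIter L U₀ j z μ : 𝔸)‖ ≤ α₁)
    -- (1.66)₀ on the sides touching `Ω₀` and the exterior-collar constant with its absorption window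
    (h66 : ∀ b ∈ {b : Site d × Fin d | SideTouches (Ω 0) b.1 b.2}, ‖((U' b.1 b.2 : 𝔸ˣ) : 𝔸) - 1‖ ≤ α₁)
    -- the boundary-layer law of the member's region (∂-layer sites of `Ω₀` lie in `Λs m 0`, `1 ≤ m ≤ K`)
    (hlay : ∀ m, 1 ≤ m → m ≤ K → ∀ y z : Site d, y ∈ Ω 0 → z ∉ Ω 0 → (∀ i, y i - 1 ≤ z i ∧ z i ≤ y i + 1) → y ∈ Λs m 0)
    {Bbd : ℝ} (hBbd : 0 ≤ Bbd) (hBd : 4 * Bbd ≤ ((d : ℝ) * L - 1) * B₀)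
    -- the level `m`
    {m : ℕ} (hm1 : 1 ≤ m) (hmK : m ≤ K)
    -- the datum at level `m`, with its masked exponent
    {u₁ : Site d → 𝔸ˣ} {U₁ : Site d → Fin d → 𝔸ˣ} {A' : Site d → Fin d → 𝔸}
    (hu₁ : ∀ x, u₁ x ∈ unitaryUnits 𝔸) (hu₁S : ∀ x, x ∉ Ω 0 → u₁ x = 1) (hW : mgauge U₀ u₁ U₁ = U')
    (h129 : Restr129 L m (Λs m) U₀ u₁)
    (hLan : IsLandau138W L m η (Ω 0) (Λs m) U₀ U₁) (hsa : ∀ y τ, IsSelfAdjoint (A' y τ))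
    (hWA : ∀ j, j ≤ m → ∀ (y : Site d) (τ : Fin d), SideTouches (Ω j) y τ →
      U₁ y τ = cfgExp η A' y τ ∧ ‖A' y τ‖ ≤ α₂ * ((L : ℝ) ^ j * η)⁻¹)
    (hA0 : ∀ (y : Site d) (τ : Fin d), (∀ j, j ≤ m → ¬ SideTouches (Ω j) y τ) → A' y τ = 0)
    -- the TWO (1.59) members for THIS datum at background `U₀`, EACH WITH THE EXTERIOR-COLLAR ALLOWANCE `+ B_∂·Φ₀(A′)`
    (h59a : msup L m η (-(1 : ℝ)) (fun j (b : Site d × Fin d) => SideTouches (Ω j) b.1 b.2) (fun b => A' b.1 b.2)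
        ≤ B₀ * (bondNorm L m η (-(3 : ℝ)) Ω (fun x μ => Jcur η U₀ A' μ x)
          + wsup 1 (fun p : {p : ℕ × (Site d × Fin d) // p.1 ≤ m ∧ (p.2 ∈ Λb m p.1 ∨ (p.1 = 0 ∧ CrossB (Ω 0) p.2))} =>
              linCovIter L U₀ (iEta η A') p.1.1 p.1.2.1 p.1.2.2))
          + Bbd * msup L m η (-(1 : ℝ)) (fun j (b : Site d × Fin d) => j = 0 ∧ SideTouches (Ω 0) b.1 b.2 ∧ ¬ BondTouches (Ω 0) b.1 b.2)
              (fun b => A' b.1 b.2))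
    (h59g : msup L m η (-(2 : ℝ)) (fun j (t : Fin d × Fin d × Site d) => SideTouches (Ω j) t.2.2 t.2.1)
          (fun t => covDerivFwd η U₀ t.1 (fun z => A' z t.2.1) t.2.2)
        ≤ B₀ * (bondNorm L m η (-(3 : ℝ)) Ω (fun x μ => Jcur η U₀ A' μ x)
          + wsup 1 (fun p : {p : ℕ × (Site d × Fin d) // p.1 ≤ m ∧ (p.2 ∈ Λb m p.1 ∨ (p.1 = 0 ∧ CrossB (Ω 0) p.2))} =>
              linCovIter L U₀ (iEta η A') p.1.1 p.1.2.1 p.1.2.2))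
          + Bbd * msup L m η (-(1 : ℝ)) (fun j (b : Site d × Fin d) => j = 0 ∧ SideTouches (Ω 0) b.1 b.2 ∧ ¬ BondTouches (Ω 0) b.1 b.2)
              (fun b => A' b.1 b.2)) :
    ∀ j, j ≤ m → ∀ (y : Site d) (κ τ : Fin d), SideTouches (Ω j) y τ →
      ((L : ℝ) ^ j * η) ^ 2 * ‖covDerivFwd η U₀ κ (fun z => A' z τ) y‖ ≤ 5 * d * L * B₀ * (α₀ + α₁) := by
  have hL1 : 1 ≤ L := le_trans (by norm_num) hL
  have hLr : (1 : ℝ) ≤ L := by exact_mod_cast hL1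
  have hU₀1 : ∀ x κ, U₀ x κ ∈ U1 𝔸 := fun x κ => unitaryUnits_le_U1 (hU₀ x κ)
  -- the datum is unitary-valued; its class (1.40)₁ by gauge invariance and locality
  have hWu : ∀ x κ, U₁ x κ ∈ unitaryUnits 𝔸 := mem_unitaryUnits_of_mgauge_eq hU₀ hU' hu₁ hW
  have h33m : InAk L m η α₀ Ω U₀ := fun j hj => h33 j (hj.trans hmK)
  have h34W : InAk L m η α₀ Ω (mulCfg U₁ U₀) := by
    have h1 : InAk L m η α₀ Ω (mulCfg U' U₀) := fun j hj => h34 j (hj.trans hmK)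
    have hui : ∀ x, u₁⁻¹ x ∈ U1 𝔸 := fun x => unitaryUnits_le_U1 ((unitaryUnits 𝔸).inv_mem (hu₁ x))
    rw [mulCfg_eq_gaugeAct_of_mgauge_eq hW]
    exact (B8Ineq132.inAk_gaugeAct_iff L m η α₀ Ω hui _).2 h1
  have h40₁ : InAk L m η α₀ Ω (mulCfg (expCfg (iEta η A')) U₀) := by
    refine (inAk_congr_of_sideTouches L m η α₀ (V := mulCfg U₁ U₀) fun j hj y τ hs => ?_).1 h34W
    show U₁ y τ * U₀ y τ = expCfg (iEta η A') y τ * U₀ y τ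
    rw [(hWA j hj y τ hs).1, expCfg_iEta_eq_cfgExp]
  have h41' : ∀ j, j ≤ m → ∀ (y : Site d) (τ : Fin d), SideTouches (Ω j) y τ → ‖A' y τ‖ ≤ α₂ * ((L : ℝ) ^ j * η)⁻¹ :=
    fun j hj y τ hs => (hWA j hj y τ hs).2
  -- the gradient datum (bounded family) and its supremum `g`
  have hgrad : ∀ (y : Site d) (κ τ : Fin d), ‖covDerivFwd η U₀ κ (fun z => A' z τ) y‖ ≤ 2 * α₂ * η⁻¹ * η⁻¹ := by
    intro y κ τ
    have h := grad_bound_trivial hη hL1 hU₀ hα₂.le h41' hA0 y κ τ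
    have hη2 : 0 < η ^ 2 := by positivity
    rw [show 2 * α₂ * η⁻¹ * η⁻¹ = 2 * α₂ / η ^ 2 by field_simp, le_div_iff₀ hη2, mul_comm]
    exact h
  have hBg : Bdd L m η (-(2 : ℝ)) (fun j (t : Fin d × Fin d × Site d) => SideTouches (Ω j) t.2.2 t.2.1)
      (fun t => covDerivFwd η U₀ t.1 (fun z => A' z t.2.1) t.2.2) := by
    have e2 : (-(2 : ℝ)) = -((2 : ℕ) : ℝ) := by norm_num
    rw [e2]
    refine B8ScaledSupNorm.bdd_of_forall (c := 2 * α₂ * ((L : ℝ) ^ m) ^ 2) fun j hj t _ => ?_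
    rw [B8ScaledSupNorm.weight_neg_natCast L η 2 j]
    have hLjm : (L : ℝ) ^ j ≤ (L : ℝ) ^ m := pow_le_pow_right₀ hLr hj
    have hLj0 : (0 : ℝ) ≤ (L : ℝ) ^ j := by positivity
    calc ((L : ℝ) ^ j * η) ^ 2 * ‖covDerivFwd η U₀ t.1 (fun z => A' z t.2.1) t.2.2‖
        ≤ ((L : ℝ) ^ j * η) ^ 2 * (2 * α₂ * η⁻¹ * η⁻¹) := mul_le_mul_of_nonneg_left (hgrad _ _ _) (by positivity)
      _ = 2 * α₂ * ((L : ℝ) ^ j) ^ 2 := by field_simp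
      _ ≤ 2 * α₂ * ((L : ℝ) ^ m) ^ 2 := by gcongr
  set g : ℝ := msup L m η (-(2 : ℝ)) (fun j (t : Fin d × Fin d × Site d) => SideTouches (Ω j) t.2.2 t.2.1)
      (fun t => covDerivFwd η U₀ t.1 (fun z => A' z t.2.1) t.2.2) with hg_def
  have hg0 : 0 ≤ g := B8ScaledSupNorm.msup_nonneg L m hη.le _ _ _
  have hg : ∀ j, j ≤ m → ∀ (y : Site d) (κ τ : Fin d), SideTouches (Ω j) y τ →
      ((L : ℝ) ^ j * η) ^ 2 * ‖covDerivFwd η U₀ κ (fun z => A' z τ) y‖ ≤ g := by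
    intro j hj y κ τ hs
    have h := B8ScaledSupNorm.weight_mul_norm_le_msup hBg hj (i := (κ, τ, y)) hs
    have hw : weight L η (-(2 : ℝ)) j = ((L : ℝ) ^ j * η) ^ 2 := by
      have e2 : (-(2 : ℝ)) = -((2 : ℕ) : ℝ) := by norm_num
      rw [e2, B8ScaledSupNorm.weight_neg_natCast L η 2 j]
    rw [hw] at h
    exact h
  -- (1.42)/(1.37) on the constraint bonds of the `m`-truncation, by the (1.42) lemma
  have h42 : ∀ j, j ≤ m → ∀ c ∈ Λb m j, ‖logCovIter L U₀ (iEta η A') j c.1 c.2‖ < 2 * d * L * α₁ :=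
    B8Eq142KLevelLocal.H42_of_inAx hd2 hη hL K hU₀ hα₀ hα₁ hα₂.le hα3 hα4 h16 hsmall hc₃ hsmall₁ Ω hΩ Λs Λb hbox hclass h33 h34 hAx
      h135 (fun m W => IsLandau138W L m η (Ω 0) (Λs m) U₀ W) m hm1 hmK u₁ U₁ A' hu₁ hW h129 hLan hsa hWA hA0
  have hboxm : ∀ j, j ≤ m → ∀ c ∈ Λb m j, ∀ x, InBox (loK L j c.1) (bondHiK L j c.1 c.2) x → x ∈ Ω j :=
    fun j hj c hc x hx => hbox m hmK j hj c hc x hx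
  -- `u₁ = 1` AT BOTH END-POINTS OF A SIDE OF `Ω₀` NOT FULLY INSIDE `Ω₀` (outer end-points: support of `u₁`; an inner end-point with a neighbour outside
  -- is a boundary-layer site, in `Λs m 0` by `hlay`, where (1.29)₀ pins `u₁ = 1`), so `U₁ = U′` there and `η‖A′‖ = ‖log U′‖ ≤ 2‖U′ − 1‖ ≤ 2α₁`
  have hdL : (1 : ℝ) ≤ (d : ℝ) * L := one_le_mul_of_one_le_of_one_le (by exact_mod_cast (le_trans (by norm_num) hd2 : 1 ≤ d)) hLr
  have hα₁4 : α₁ ≤ 1 / 4 := by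
    have h1 : α₁ ≤ (d : ℝ) * L * α₁ := le_mul_of_one_le_left hα₁.le hdL
    linarith [h1, hsmall₁]
  have he1 : ∀ (b : Site d × Fin d) (i : Fin d), b.1 i - 1 ≤ (b.1 + e b.2) i ∧ (b.1 + e b.2) i ≤ b.1 i + 1 := by
    intro b i
    simp only [Pi.add_apply, e_apply]
    split_ifs <;> constructor <;> omega
  have he2 : ∀ (b : Site d × Fin d) (i : Fin d), (b.1 + e b.2) i - 1 ≤ b.1 i ∧ b.1 i ≤ (b.1 + e b.2) i + 1 := by
    intro b i
    simp only [Pi.add_apply, e_apply]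
    split_ifs <;> constructor <;> omega
  have hu1 : ∀ b : Site d × Fin d, ¬ (b.1 ∈ Ω 0 ∧ b.1 + e b.2 ∈ Ω 0) → u₁ b.1 = 1 ∧ u₁ (b.1 + e b.2) = 1 := by
    intro b hnb
    refine ⟨?_, ?_⟩
    · by_cases h : b.1 ∈ Ω 0
      · exact Units.val_eq_one.mp (B8Eq119TwistedAxial.restr129_level_zero h129
          (hlay m hm1 hmK b.1 (b.1 + e b.2) h (fun h' => hnb ⟨h, h'⟩) (he1 b)))
      · exact hu₁S _ h
    · by_cases h : b.1 + e b.2 ∈ Ω 0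
      · exact Units.val_eq_one.mp (B8Eq119TwistedAxial.restr129_level_zero h129
          (hlay m hm1 hmK (b.1 + e b.2) b.1 h (fun h' => hnb ⟨h', h⟩) (he2 b)))
      · exact hu₁S _ h
  have hcol : ∀ b : Site d × Fin d, SideTouches (Ω 0) b.1 b.2 → ¬ (b.1 ∈ Ω 0 ∧ b.1 + e b.2 ∈ Ω 0) → η * ‖A' b.1 b.2‖ ≤ 2 * α₁ := by
    intro b hsd hnb
    obtain ⟨hx, hxe⟩ := hu1 b hnb
    have hWb : U₁ b.1 b.2 = U' b.1 b.2 := by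
      have h := congrFun (congrFun hW b.1) b.2
      rw [mgauge_apply, hx, hxe, one_mul] at h
      simpa using h
    -- `A′_b = (1/iη) log U₁_b` (smallness from (1.68) at level `0`)
    obtain ⟨hWe, hAb⟩ := hWA 0 (Nat.zero_le _) b.1 b.2 hsd
    have hsm : η * ‖A' b.1 b.2‖ ≤ 1 / 2 := by
      rw [pow_zero, one_mul] at hAb
      calc η * ‖A' b.1 b.2‖ ≤ η * (α₂ * η⁻¹) := mul_le_mul_of_nonneg_left hAb hη.le
        _ = α₂ := by field_simp
        _ ≤ 1 / 2 := by linarith [h16, hα₂.le]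
    have hlog : logCfg η U₁ b.1 b.2 = A' b.1 b.2 := logCfg_eq_of_cfgExp hη hWe hsm
    have hU'1 : ‖((U' b.1 b.2 : 𝔸ˣ) : 𝔸) - 1‖ ≤ 1 / 2 := (h66 b hsd).trans (by linarith [hα₁4])
    rw [← hlog, logCfg, hWb, norm_smul, norm_smul, norm_inv, norm_inv, Complex.norm_I, inv_one, one_mul, Real.norm_eq_abs,
      abs_of_pos hη, ← mul_assoc, mul_inv_cancel₀ hη.ne', one_mul]
    exact (MatrixLog.norm_mlog_le_two_mul hU'1).trans (by linarith [h66 b hsd])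
  -- THE EXTERIOR-COLLAR TERM `Φ₀(A′) ≤ 2α₁` (outer sides) and its window under `4B_∂ ≤ (dL − 1)B₀`
  set Φ₀ : ℝ := msup L m η (-(1 : ℝ)) (fun j (b : Site d × Fin d) => j = 0 ∧ SideTouches (Ω 0) b.1 b.2 ∧ ¬ BondTouches (Ω 0) b.1 b.2)
      (fun b => A' b.1 b.2) with hΦ₀_def
  have hΦ₀ : Φ₀ ≤ 2 * α₁ := by
    refine B8ScaledSupNorm.msup_le (by linarith) fun j hj b hb => ?_
    obtain ⟨rfl, hsd, hnb⟩ := hb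
    have e1 : (-(1 : ℝ)) = -((1 : ℕ) : ℝ) := by norm_num
    rw [e1, B8ScaledSupNorm.weight_neg_natCast L η 1 0, pow_one, pow_zero, one_mul]
    exact hcol b hsd fun h => hnb (Or.inl h.1)
  have hdr : (1 : ℝ) ≤ d := by exact_mod_cast (le_trans (by norm_num) hd2 : 1 ≤ d)
  have hdL1 : (0 : ℝ) ≤ (d : ℝ) * L - 1 := by nlinarith [hdr, hLr]
  have hbdry : 4 * Bbd * α₁ ≤ ((d : ℝ) * L - 1) * B₀ * (α₀ + α₁) := by
    have h1 : 4 * Bbd * α₁ ≤ ((d : ℝ) * L - 1) * B₀ * α₁ := mul_le_mul_of_nonneg_right hBd hα₁.le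
    have h2 : ((d : ℝ) * L - 1) * B₀ * α₁ ≤ ((d : ℝ) * L - 1) * B₀ * (α₀ + α₁) :=
      mul_le_mul_of_nonneg_left (by linarith) (mul_nonneg hdL1 hB₀)
    exact h1.trans h2
  have hβg : 2 * (Bbd * Φ₀) ≤ ((d : ℝ) * L - 1) * B₀ * (α₀ + α₁) := by
    have h1 := mul_le_mul_of_nonneg_left hΦ₀ hBbd
    linarith only [h1, hbdry]
  -- PROPOSITION 3 at `m` levels for `A′` in edition β: (1.55), «|B₁|β < 2dLα₁ + C₂α₂²» (on the constraint bonds by (1.42) + (1.37); on a level-0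
  -- CROSSING bond `Q₀ = 1` and the term is `η‖A′(b)‖ ≤ 2α₁ ≤ 2dLα₁`, `hcol`), the bootstrap and the slack of (1.60) ⇒ (1.62) — the gradient member
  have h55 := B8Eq155KLevelLocal.eq155_norm_kLevel_hermitian hη hL1 hU₀1 hsa hα₀.le hα₂.le h16 hd5 hg0 h33m h40₁ h41' hg
  have h41'' : ∀ j, j ≤ m → ∀ x μ, BondTouches (Ω j) x μ → ‖A' x μ‖ ≤ α₂ * ((L : ℝ) ^ j * η)⁻¹ :=
    fun j hj x μ hb => B8Prop3KLevel.bound_of_sideTouches hd2 (h41' j hj) x μ hb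
  have hC0 : 0 ≤ 8 * (131072 * ((d : ℝ) + 1) ^ 2) * Real.exp (4 * (800 * ((d : ℝ) + 1) ^ 2 * ((d : ℝ) + 4)) * α₀) * α₂ ^ 2 := by
    positivity
  haveI : Nontrivial (Fin d) := Fin.nontrivial_iff_two_le.mpr hd2
  obtain ⟨-, hg'', -, -⟩ := B8Prop3KLevelBdry.apriori_160_bdry (L := (L : ℝ)) (B₀ := B₀) (α₁ := α₁)
    (C₂ := 8 * (131072 * ((d : ℝ) + 1) ^ 2) * Real.exp (4 * (800 * ((d : ℝ) + 1) ^ 2 * ((d : ℝ) + 4)) * α₀))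
    (Nat.cast_nonneg d) hB₀ hα₂.le hg0 h55
    (by
      refine B8Eq155JBound.wsup_le (fun p => ?_) (by positivity)
      obtain ⟨⟨j, b⟩, hj, hc | ⟨hj0, hcr⟩⟩ := p
      · have hj' : j ≤ m := hj
        have hc' : b ∈ Λb m j := hc
        show 1 * ‖linCovIter L U₀ (iEta η A') j b.1 b.2‖ ≤ _
        rw [one_mul]
        exact (B8Eq156KLevelLocal.norm_B1_lt_kLevel hη L hL (avgClosed_unitaryUnits d L) U₀ hU₀ hα₀ hα3 hα4 A' hα₂.le hsmall hc₃
          hboxm h33m h41'' h42 hj' hc').le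
      · have hj0' : j = 0 := hj0
        subst hj0'
        have hbt' : BondTouches (Ω 0) b.1 b.2 := hcr.1
        have hnb' : ¬ (b.1 ∈ Ω 0 ∧ b.1 + e b.2 ∈ Ω 0) := hcr.2
        show 1 * ‖linCovIter L U₀ (iEta η A') 0 b.1 b.2‖ ≤ _
        rw [one_mul, B7Prop4GeneralLevels.linCovIter_zero, B8Eq154Local.norm_iEta_apply hη.le]
        obtain ⟨κ, hκ⟩ := exists_ne b.2
        have hsd : SideTouches (Ω 0) b.1 b.2 := B8Eq140Level.sideTouches_of_bondTouches hκ hbt'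
        have h1 : 2 * α₁ ≤ 2 * d * L * α₁ := by
          have h := mul_le_mul_of_nonneg_right hdL (by positivity : (0 : ℝ) ≤ 2 * α₁)
          linarith only [h]
        linarith only [hcol b hsd hnb', h1, hC0])
    h59a h59g h59a h59a hside h50
  set R₀ := B₀ * (4 * α₀ + 4 * d * L * α₁ + 2 * α₂ ^ 2 + 20 * d * α₀ * α₂
      + 2 * (8 * (131072 * ((d : ℝ) + 1) ^ 2) * Real.exp (4 * (800 * ((d : ℝ) + 1) ^ 2 * ((d : ℝ) + 4)) * α₀))
        * α₂ ^ 2) with hR₀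
  set R₁ := B₀ * (4 * α₀ + 4 * d * L * α₁ + 2 * α₂ ^ 2 + 20 * d * α₀ * α₂ + 2 * C₂ * α₂ ^ 2) with hR₁
  have hR : R₀ ≤ R₁ := by
    rw [hR₀, hR₁]
    apply mul_le_mul_of_nonneg_left _ hB₀
    have hsq : 0 ≤ α₂ ^ 2 := sq_nonneg _
    have hCC := mul_le_mul_of_nonneg_right hC₂ hsq
    linarith only [hCC]
  have h162g : R₁ + 2 * (Bbd * Φ₀) ≤ 5 * d * L * B₀ * (α₀ + α₁) := by
    rw [hR₁]; exact B8Prop3KLevelBdry.apriori_162_bdry hB₀ hdL hα₀.le h61 hβg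
  have hg' : g ≤ 5 * d * L * B₀ * (α₀ + α₁) := by linarith only [hg'', hR, h162g]
  intro j hj y κ τ hs
  exact (hg j hj y κ τ hs).trans hg'

end Grad

/-! ## §2 THE LEVEL-`m` ASSEMBLY: the ∃λ-body of `SockHFP` from the JOIN, the datum dictionary and the β (1.59) clause -/
section Body

variable {𝔸 : Type*} [CStarAlgebra 𝔸] [Nontrivial 𝔸]
/-- ★ **PROPOSITION 5'S FIXED POINT FOR THE LEVEL-`m` DATUM OF THEOREM 4, [4]'s INVERSE LAWS ON PRINT'S DOMAINS, WITH THEOREM 4'S OWN (1.59)-CLAUSE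
IN EDITION β IN PLACE OF THE b9 SOCKET** — g7's `B8SockHFP59Bdry.sockHFP_body_of_join_59_bdry` VERBATIM except: the in-edge `H59Dm ↦ H59Dβm` (the two-member
β clause: `|B₁|β` over `Λb m j ∪ {level-0 crossing bonds}`, exterior-collar allowance) and the displayed boundary-layer law `hlay` of the member's region; the
source bound comes from §1's `grad_bound_of_datum59_bdryβ`.
[cite: Balaban1985RegularSpaces, Prop. 5 (1.106)–(1.109) p.94, Thm 4 p.88, (1.66)–(1.69) p.88, p.89, (1.31) p.82, (1.92)–(1.103) pp.92–93; Balaban1985BackgroundPropagators, Thm 3.1 p.397, (3.25) p.394, Thm 3.3 p.398, (3.16) p.393] -/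
theorem sockHFP_body_of_join_59_bdryβ (hd2 : 2 ≤ d) {L : ℕ} (hL : 2 ≤ L) {η : ℝ} (hη : 0 < η) {k : ℕ}
    -- the member's geometry
    {Ω : ℕ → Set (Site d)} (hΩ : ∀ j, Ω (j + 1) ⊆ Ω j) {Λs : ℕ → ℕ → Set (Site d)} {Λb : ℕ → ℕ → Set (Site d × Fin d)}
    (hbox : ∀ m, m ≤ k → ∀ j, j ≤ m → ∀ c ∈ Λb m j, ∀ x, InBox (loK L j c.1) (bondHiK L j c.1 c.2) x → x ∈ Ω j)
    (hclass : ∀ m, m ≤ k → ∀ j, j ≤ m → ∀ c ∈ Λb m j,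
      (c.1 ∈ Λs m j ∧ c.1 + e c.2 ∈ Λs m j) ∨
      (∃ j', j = j' + 1 ∧ (∀ x, (L : ℤ) • c.1 ≤ x → x ≤ (L : ℤ) • c.1 + blockTop L → x ∈ Λs m j') ∧ c.1 + e c.2 ∈ Λs m j) ∨
      (∃ j', j = j' + 1 ∧ c.1 ∈ Λs m j ∧ (∀ x, (L : ℤ) • (c.1 + e c.2) ≤ x → x ≤ (L : ℤ) • (c.1 + e c.2) + blockTop L → x ∈ Λs m j')))
    {m : ℕ} (hm1 : 1 ≤ m) (hmk : m < k)
    (htower : ∀ j, j ≤ m + 1 → ∀ y ∈ Λs (m + 1) j, ∀ x, InBox (tlo L y j) (thi L y j) x → x ∈ Ω j)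
    (hlt : ∀ j, j < m → Λs m j = Λs (m + 1) j)
    (htop : ∀ x, x ∈ Λs m m ↔ x ∈ Λs (m + 1) m ∨ ∃ y ∈ Λs (m + 1) (m + 1), x ∈ blockSites L y)
    -- the socket's antecedents: constants, (1.33), (1.34), (1.35)/(1.66)
    {α₀ α₁ B₀ B₀' cs α₄ : ℝ} (hα₀ : 0 < α₀) (hα₁ : 0 < α₁) (hB₀ : 0 < B₀) (hB₀' : 0 < B₀')
    (hcs : cs = 5 * (d : ℝ) * L * B₀ * (α₀ + α₁)) (hα₄ : α₄ = 8 * B₀' * (5 * (d : ℝ) * L * B₀) * (α₀ + α₁))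
    {U₀ U' : Site d → Fin d → 𝔸ˣ} (hU₀ : ∀ x κ, U₀ x κ ∈ unitaryUnits 𝔸) (hU' : ∀ x κ, U' x κ ∈ unitaryUnits 𝔸)
    (h33 : InAk L k η α₀ Ω U₀) (h34 : InAk L k η α₀ Ω (mulCfg U' U₀)) (hAx : ∀ m', m' ≤ k → InAx L m' (Λs m') U₀ (mulCfg U' U₀))
    (h135 : ∀ j, j ≤ k → ∀ (z : Site d) (μ : Fin d), (∀ x, InBox (loK L j z) (bondHiK L j z μ) x → x ∈ Ω j) →
      ‖(avgIter L (mulCfg U' U₀) j z μ : 𝔸) - (avgIter L U₀ j z μ : 𝔸)‖ ≤ α₁)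
    (h66 : ∀ b ∈ {b : Site d × Fin d | SideTouches (Ω 0) b.1 b.2}, ‖((U' b.1 b.2 : 𝔸ˣ) : 𝔸) - 1‖ ≤ α₁)
    -- the boundary-layer law of the member's region
    (hlay : ∀ m, 1 ≤ m → m ≤ k → ∀ y z : Site d, y ∈ Ω 0 → z ∉ Ω 0 → (∀ i, y i - 1 ≤ z i ∧ z i ≤ y i + 1) → y ∈ Λs m 0)
    -- the exterior-collar constant and its absorption window
    {Bbd : ℝ} (hBbd : 0 ≤ Bbd) (hBd : 4 * Bbd ≤ ((d : ℝ) * L - 1) * B₀)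
    -- the datum at level `m`
    {u₁ : Site d → 𝔸ˣ} {U₁ : Site d → Fin d → 𝔸ˣ} {A : Site d → Fin d → 𝔸}
    (hu₁ : ∀ x, u₁ x ∈ unitaryUnits 𝔸) (hu₁S : ∀ x, x ∉ Ω 0 → u₁ x = 1) (hW : mgauge U₀ u₁ U₁ = U')
    (h129 : Restr129 L m (Λs m) U₀ u₁)
    (hLan : IsLandau138W L m η (Ω 0) (Λs m) U₀ U₁)
    (hdat : ∀ j, j ≤ m → ∀ b ∈ {b : Site d × Fin d | SideTouches (Ω j) b.1 b.2},
      U₁ b.1 b.2 = cfgExp η A b.1 b.2 ∧ IsSelfAdjoint (A b.1 b.2) ∧ ‖A b.1 b.2‖ ≤ cs * ((L : ℝ) ^ j * η)⁻¹)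
    -- Theorem 4's own TWO-member (1.59) clause for the level-`m` datum at background `U₀`, WITH THE EXTERIOR-COLLAR ALLOWANCE
    (H59Dβm : ∀ A' : Site d → Fin d → 𝔸, (∀ y τ, IsSelfAdjoint (A' y τ)) →
      (∀ j, j ≤ m → ∀ (y : Site d) (τ : Fin d), SideTouches (Ω j) y τ →
        U₁ y τ = cfgExp η A' y τ ∧ ‖A' y τ‖ ≤ cs * ((L : ℝ) ^ j * η)⁻¹) →
      (∀ (y : Site d) (τ : Fin d), (∀ j, j ≤ m → ¬ SideTouches (Ω j) y τ) → A' y τ = 0) →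
      msup L m η (-(1 : ℝ)) (fun j (b : Site d × Fin d) => SideTouches (Ω j) b.1 b.2) (fun b => A' b.1 b.2)
          ≤ B₀ * (bondNorm L m η (-(3 : ℝ)) Ω (fun x μ => Jcur η U₀ A' μ x)
            + wsup 1 (fun p : {p : ℕ × (Site d × Fin d) // p.1 ≤ m ∧ (p.2 ∈ Λb m p.1 ∨ (p.1 = 0 ∧ CrossB (Ω 0) p.2))} =>
                linCovIter L U₀ (iEta η A') p.1.1 p.1.2.1 p.1.2.2))
            + Bbd * msup L m η (-(1 : ℝ)) (fun j (b : Site d × Fin d) => j = 0 ∧ SideTouches (Ω 0) b.1 b.2 ∧ ¬ BondTouches (Ω 0) b.1 b.2)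
                (fun b => A' b.1 b.2) ∧
        msup L m η (-(2 : ℝ)) (fun j (t : Fin d × Fin d × Site d) => SideTouches (Ω j) t.2.2 t.2.1)
            (fun t => covDerivFwd η U₀ t.1 (fun z => A' z t.2.1) t.2.2)
          ≤ B₀ * (bondNorm L m η (-(3 : ℝ)) Ω (fun x μ => Jcur η U₀ A' μ x)
            + wsup 1 (fun p : {p : ℕ × (Site d × Fin d) // p.1 ≤ m ∧ (p.2 ∈ Λb m p.1 ∨ (p.1 = 0 ∧ CrossB (Ω 0) p.2))} =>
                linCovIter L U₀ (iEta η A') p.1.1 p.1.2.1 p.1.2.2))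
            + Bbd * msup L m η (-(1 : ℝ)) (fun j (b : Site d × Fin d) => j = 0 ∧ SideTouches (Ω 0) b.1 b.2 ∧ ¬ BondTouches (Ω 0) b.1 b.2)
                (fun b => A' b.1 b.2))
    -- Proposition 3's windows at `(α₀, α₂ := c⋆)` not implied by the JOIN's
    {C₂ : ℝ} (hside : 36 * d * B₀ * cs ≤ 1 / 2)
    (hC₂ : 8 * (131072 * ((d : ℝ) + 1) ^ 2) * Real.exp (4 * (800 * ((d : ℝ) + 1) ^ 2 * ((d : ℝ) + 4)) * α₀) ≤ C₂)
    (h61 : 2 * cs ^ 2 + 20 * d * α₀ * cs + 2 * C₂ * cs ^ 2 ≤ α₀ + α₁) (hsmall₁ : (d : ℝ) * L * α₁ ≤ 1 / 8)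
    -- the [4] LETTERS at `(m + 1, U₀)`, displayed as the JOIN reads them
    (g Δ : (Site d → 𝔸) →ₗ[ℂ] (Site d → 𝔸)) (q : (Site d → 𝔸) →ₗ[ℂ] (ℕ → Site d → 𝔸)) (qs : (ℕ → Site d → 𝔸) →ₗ[ℂ] (Site d → 𝔸))
    (Aw c : (ℕ → Site d → 𝔸) →ₗ[ℂ] (ℕ → Site d → 𝔸))
    (g_rightΩ : ∀ x, ∀ y ∈ Ω 0, (Δ (g x) + qs (Aw (q (g x)))) y = x y)
    (c_range : ∀ f, q (g (g (qs (c (q f))))) = q f)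
    (hΔ : ∀ (f : Site d → 𝔸), ∀ x ∈ Ω 0, Δ f x = covLap η U₀ ((Ω 0).indicator f) x)
    (hqs : ∀ (μ : ℕ → Site d → 𝔸), ∀ x ∈ Ω 0, qs μ x = QT L (m + 1) (Λs (m + 1)) U₀ μ x)
    (hq : ∀ (f : Site d → 𝔸) (j : ℕ), j ≤ m + 1 → ∀ y ∈ Λs (m + 1) j, q f j y = QprimeIter (zdBlocking d L) (bgT L U₀) j f y)
    (H' : XSpace d (m + 1) 𝔸 →ₗ[ℂ] (Site d → 𝔸)) {B₀'H B₂' BG BR : ℝ} (hB₀'H : 0 < B₀'H) (hB₂' : 0 ≤ B₂') (hBG : 0 ≤ BG) (hBR : 0 ≤ BR)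
    (hH0 : ∀ (X : XSpace d (m + 1) 𝔸) (x : Site d), ‖H' X x‖ ≤ B₀'H * ‖X‖)
    (hH1 : ∀ j, j ≤ m + 1 → ∀ (X : XSpace d (m + 1) 𝔸), ∀ p ∈ {b : Site d × Fin d | SideTouches (Ω j) b.1 b.2},
      wt L η j * ‖covDerivFwd η U₀ p.2 (H' X) p.1‖ ≤ B₀'H * ‖X‖)
    (hH2 : ∀ X : XSpace d (m + 1) 𝔸, Bd2 L η (m + 1) Ω (covLap η U₀ (H' X)) (B₂' * ‖X‖))
    (hHsupp : ∀ (X : XSpace d (m + 1) 𝔸) (x : Site d), x ∉ Ω 0 → H' X x = 0)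
    (hHequiv : ∀ X Y : XSpace d (m + 1) 𝔸, (∀ p, Y p = -star (X p)) → ∀ x, H' Y x = -star (H' X x))
    (hQH : ∀ (Y : XSpace d (m + 1) 𝔸) (j : ℕ) (hj : j ≤ m + 1) (y : Site d), y ∈ Λs (m + 1) j →
      QprimeIter (zdBlocking d L) (bgT L U₀) j (H' Y) y = Y (⟨j, Nat.lt_succ_of_le hj⟩, y))
    (hG : ∀ (f : Site d → 𝔸) (r : ℝ), 0 ≤ r → Bd2 L η (m + 1) Ω f r →
      (∀ x, ‖g f x‖ ≤ BG * r) ∧ ∀ j, j ≤ m + 1 → ∀ p ∈ {b : Site d × Fin d | SideTouches (Ω j) b.1 b.2},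
        wt L η j * ‖covDerivFwd η U₀ p.2 (g f) p.1‖ ≤ BG * r)
    (hGsupp : ∀ (f : Site d → 𝔸) (x : Site d), x ∉ Ω 0 → g f x = 0)
    (hGreal : ∀ f : Site d → 𝔸, (∀ j, j ≤ m + 1 → ∀ x ∈ Ω j, IsSelfAdjoint (f x)) → ∀ x, IsSelfAdjoint (g f x))
    (hRbd : ∀ (f : Site d → 𝔸) (r : ℝ), 0 ≤ r → Bd2 L η (m + 1) Ω f r → Bd2 L η (m + 1) Ω (f - g (qs (c (q (g f))))) (BR * r))
    (hRreal : ∀ f : Site d → 𝔸, (∀ j, j ≤ m + 1 → ∀ x ∈ Ω j, IsSelfAdjoint (f x)) →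
      ∀ j, j ≤ m + 1 → ∀ x ∈ Ω j, IsSelfAdjoint ((f - g (qs (c (q (g f))))) x))
    -- the JOIN's scalar windows, one-for-one (`αP := α₀`, `α₄ := 8B₀′c⋆`; `cB cA cDA` free above their datum values)
    {cB cA cDA : ℝ} (hcBlo : L * cs ≤ cB) (hcAlo : L * cs ≤ cA) (hcDAlo : (d : ℝ) * (L : ℝ) ^ 2 * cs ≤ cDA)
    (hα3 : C0 d * α₀ ≤ 1 / 3) (hα4 : 4 * α₀ ≤ c2' d L)
    (hsmall : Real.exp (4 * (800 * ((d : ℝ) + 1) ^ 2 * ((d : ℝ) + 4)) * α₀) * (1 + 8 * (131072 * ((d : ℝ) + 1) ^ 2) * cB) ≤ 2)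
    (hc₃ : 2 * cB ≤ c3 d L) (hsc : 2048 * (d : ℝ) * cB ≤ 1) (hα₃' : 40 * d * cB ≤ 1 / 200)
    (hs₁ : 200 * C6 d * (2 * α₄) ≤ 1) (hs₂ : 12000 * ((d : ℝ) + 1) * L * (2 * α₄) ≤ 1)
    (hs₃ : C4G d L * (α₀ + 40 * d * cB + 4 * (2 * α₄)) ≤ 1)
    (hs₄ : 1024 * ((d : ℝ) + 1) * ((d : ℝ) + 4) * L ^ 2 * α₀ ≤ 1) (hs₅ : 32 * ((d : ℝ) + 1) ^ 2 * C6 d * L ^ 2 * α₀ ≤ 1)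
    (hs₆ : 16 * d * C5' d * C6 d * (L : ℝ) ^ 2 * α₀ ≤ 1) (hs₇ : 8 * d * C6 d * L * α₀ ≤ 1)
    (hsm : 40 * d * cB + α₄ ≤ 1 / (4 * B₀'H * (2 * C2p d))) (hprod8 : 2 * C6 d * (40 * d * cB + 4 * α₄) ≤ 1 / 8)
    {hE hE₂ lE lE₂ : ℝ} (hE_def : hE = B₀'H * (C2p d * (40 * d * cB + α₄) * α₄)) (hE₂_def : hE₂ = B₂' * (C2p d * (40 * d * cB + α₄) * α₄))
    (lE_def : lE = B₀'H * (4 * C2p d * (40 * d * cB + 2 * α₄))) (lE₂_def : lE₂ = B₂' * (4 * C2p d * (40 * d * cB + 2 * α₄)))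
    (hcA' : cA ≤ 1 / 13) (ha₁' : α₄ / 4 + hE ≤ 1 / 24) (hb₁' : α₄ / 4 + hE ≤ 1 / 140) (hθ : 10 * (α₄ / 4 + hE) * BR ≤ 1 / 2)
    (h103 : BG * Mc d BR (α₄ / 4 + hE) cA hE₂ cDA ≤ α₄ / 4)
    (h106 : BG * Kc d BR (α₄ / 4 + hE) cA hE₂ cDA lE₂ (1 + lE) (1 + lE) ≤ 1 / 2) :
    ∃ lam : Site d → 𝔸, (∀ x, IsSelfAdjoint (lam x)) ∧ (∀ x, x ∉ Ω 0 → lam x = 0) ∧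
      (∀ j, j ≤ m + 1 → ∀ b ∈ {b : Site d × Fin d | SideTouches (Ω j) b.1 b.2},
        ‖lam b.1‖ ≤ α₄ ∧ ((L : ℝ) ^ j * η) * ‖covDerivFwd η U₀ b.2 lam b.1‖ ≤ α₄) ∧
      (∃ μ : ℕ → Site d → 𝔸, ∀ x ∈ Ω 0,
        covLap η U₀ ((Ω 0).indicator fun y => covDivB η U₀ A y + covLap η U₀ lam y +
          ((conjR (gaugeExp lam y)⁻¹ (covDivB η U₀ A y) - covDivB η U₀ A y) +
            (gAd (covLap η U₀ lam y) (lam y) - covLap η U₀ lam y) + ∑ μ, frakF3 η U₀ lam A y μ)) x =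
          QT L (m + 1) (Λs (m + 1)) U₀ μ x) ∧
      Restr129 L (m + 1) (Λs (m + 1)) U₀ (u₁ * gaugeExp lam) := by
  subst hcs
  have hL1 : 1 ≤ L := le_trans (by norm_num) hL
  have hd1 : 1 ≤ d := le_trans (by norm_num) hd2
  have hLr : (1 : ℝ) ≤ L := by exact_mod_cast hL1
  have hmK : m + 1 ≤ k := hmk
  have hsum : 0 < α₀ + α₁ := add_pos hα₀ hα₁
  have hcs0 : 0 ≤ 5 * (d : ℝ) * L * B₀ * (α₀ + α₁) := by positivity
  have hcspos : 0 < 5 * (d : ℝ) * L * B₀ * (α₀ + α₁) := by positivity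
  have hα₄pos : 0 < α₄ := by rw [hα₄]; positivity
  -- `c⋆ ≤ L·c⋆ ≤ cB`, hence Prop. 3's remaining windows from the JOIN's
  have hcsB : 5 * (d : ℝ) * L * B₀ * (α₀ + α₁) ≤ cB := (le_mul_of_one_le_left hcs0 hLr).trans hcBlo
  have hcB0 : 0 ≤ cB := hcs0.trans hcsB
  have hcA0 : 0 ≤ cA := (hcs0.trans (le_mul_of_one_le_left hcs0 hLr)).trans hcAlo
  have hcDA0 : 0 ≤ cDA := le_trans (by positivity) hcDAlo
  have hd0 : (1 : ℝ) ≤ d := by exact_mod_cast hd1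
  have hcBsmall : (d : ℝ) * cB ≤ 1 / 8000 := by linarith only [hα₃']
  have hdcs : (d : ℝ) * (5 * (d : ℝ) * L * B₀ * (α₀ + α₁)) ≤ 1 / 8000 :=
    (mul_le_mul_of_nonneg_left hcsB (by positivity)).trans hcBsmall
  have hcs8000 : 5 * (d : ℝ) * L * B₀ * (α₀ + α₁) ≤ 1 / 8000 := (le_mul_of_one_le_left hcs0 hd0).trans hdcs
  have h16 : 16 * (5 * (d : ℝ) * L * B₀ * (α₀ + α₁)) ≤ 1 := by linarith only [hcs8000]
  have h50 : 50 * d * (5 * (d : ℝ) * L * B₀ * (α₀ + α₁)) ≤ 1 := by linarith only [hdcs]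
  have hd5 : 5 * (5 * (d : ℝ) * L * B₀ * (α₀ + α₁)) * ((d : ℝ) - 1) ≤ 4 := by nlinarith only [hdcs, hcs0]
  have hc₃3 : 2 * (5 * (d : ℝ) * L * B₀ * (α₀ + α₁)) ≤ c3 d L := by linarith only [hc₃, hcsB]
  have hsmall3 : Real.exp (4 * (800 * ((d : ℝ) + 1) ^ 2 * ((d : ℝ) + 4)) * α₀) *
      (1 + 8 * (131072 * ((d : ℝ) + 1) ^ 2) * (5 * (d : ℝ) * L * B₀ * (α₀ + α₁))) ≤ 2 := by
    refine le_trans (mul_le_mul_of_nonneg_left ?_ (Real.exp_pos _).le) hsmall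
    have h := mul_le_mul_of_nonneg_left hcsB (show (0 : ℝ) ≤ 8 * (131072 * ((d : ℝ) + 1) ^ 2) by positivity)
    linarith only [h]
  have hαP2 : 2 * α₀ ≤ c2' d L := by linarith only [hα4, hα₀]
  -- the MASKED exponent `A′` of the datum (globally Hermitian, `= A` on the touched bonds)
  obtain ⟨A', hsa, hagree, hWA, hA0⟩ := exists_masked_datum hdat
  have hWA1 : ∀ j, j ≤ m → ∀ (y : Site d) (τ : Fin d), SideTouches (Ω j) y τ → U₁ y τ = cfgExp η A' y τ :=
    fun j hj y τ hs => (hWA j hj y τ hs).1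
  have h41 : ∀ j, j ≤ m → ∀ (y : Site d) (τ : Fin d), SideTouches (Ω j) y τ →
      ‖A' y τ‖ ≤ (5 * (d : ℝ) * L * B₀ * (α₀ + α₁)) * ((L : ℝ) ^ j * η)⁻¹ := fun j hj y τ hs => (hWA j hj y τ hs).2
  -- the JOIN's datum binders BY NAME (`B8Prop5SocketDatum` §7, §1, §5)
  have h33' := h33_of_inAk hL1 hα₀ h33 hmK htower
  have hP' := hP_of_datum hL1 hα₀ hΩ h34 hmK htower hu₁ hW hWA1
  have h69' : ∀ j, j ≤ m + 1 → ∀ y ∈ Λs (m + 1) j, ∀ (x : Site d) (κ : Fin d), InBox (tlo L y j) (thi L y j) x →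
      InBox (tlo L y j) (thi L y j) (x + e κ) → ‖iEta η A' x κ‖ ≤ cB * ((L : ℝ) ^ j)⁻¹ :=
    fun j hj y hy x κ hx hxe =>
      (h69_of_datum hd2 hL1 hη hΩ htower hcs0 h41 j hj y hy x κ hx hxe).trans (mul_le_mul_of_nonneg_right hcBlo (by positivity))
  have hA' : ∀ j, j ≤ m + 1 → ∀ x ∈ Ω j, ∀ μ : Fin d,
      wt L η j * ‖A' x μ‖ ≤ cA ∧ wt L η j * ‖conjR (U₀ (x - e μ) μ)⁻¹ (A' (x - e μ) μ)‖ ≤ cA := fun j hj x hx μ =>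
    ⟨(hA_of_datum hd2 hL1 hη hΩ hU₀ hcs0 h41 j hj x hx μ).1.trans hcAlo, (hA_of_datum hd2 hL1 hη hΩ hU₀ hcs0 h41 j hj x hx μ).2.trans hcAlo⟩
  have hBu : ∀ (x : Site d) (κ : Fin d), expCfg (iEta η A') x κ ∈ unitaryUnits 𝔸 := expCfg_iEta_mem_unitaryUnits η hsa
  have hAx' : InAx L (m + 1) (Λs (m + 1)) U₀ (mgauge U₀ u₁ (expCfg (iEta η A')) * U₀) :=
    inAx_mgauge_expCfg_of_datum hd2 hL1 hΩ htower hW hWA1 (hAx (m + 1) hmK)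
  have h129' : Restr129 L (m + 1) (Λs (m + 1)) U₀ u₁ := restr129_succ_of_truncation hL1 hlt htop h129
  -- the source `D*A′`: (1.69)'s gradient member by Prop. 3 at level `m` (§3), then `|D*A′|₍₋₂₎ ≤ d·L²·c⋆ ≤ cDA` (§4); Hermitian
  obtain ⟨h59a, h59g⟩ := H59Dβm A' hsa hWA hA0
  have hgrad := grad_bound_of_datum59_bdryβ hd2 hη hL k hU₀ hU' hα₀ hα₁ hcspos hB₀.le hα3 hα4 h16 hd5 hsmall3 hc₃3 hside h50 hC₂ h61
    hsmall₁ Ω hΩ Λs Λb hbox hclass h33 h34 hAx h135 h66 hlay hBbd hBd hm1 hmk.le hu₁ hu₁S hW h129 hLan hsa hWA hA0 h59a h59g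
  have hDA : Bd2 L η (m + 1) Ω (fun y => covDivB η U₀ A' y) cDA := fun j hj x hx =>
    (bd2_covDivB_of_grad hd2 hL1 hη hΩ hU₀ hcs0 hgrad j hj x hx).trans hcDAlo
  have hDAsa : ∀ j, j ≤ m + 1 → ∀ x ∈ Ω j, IsSelfAdjoint (covDivB η U₀ A' x) := fun j _ x _ => isSelfAdjoint_covDivB hU₀ hsa x
  -- the JOIN's bond classes `Eb j := {b ∣ SideTouches (Ω j) b}` (§6)
  have hEbΩ : ∀ j, j ≤ m + 1 → ∀ x ∈ Ω j, ∀ μ : Fin d, (x, μ) ∈ {b : Site d × Fin d | SideTouches (Ω j) b.1 b.2} ∧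
      (x - e μ, μ) ∈ {b : Site d × Fin d | SideTouches (Ω j) b.1 b.2} := fun j _ x hx μ => sideTouches_pair_of_mem hd2 hx μ
  have hEbT : ∀ j, j ≤ m + 1 → ∀ y ∈ Λs (m + 1) j, ∀ (x : Site d) (κ : Fin d), InBox (tlo L y j) (thi L y j) x →
      InBox (tlo L y j) (thi L y j) (x + e κ) → (x, κ) ∈ {b : Site d × Fin d | SideTouches (Ω j) b.1 b.2} :=
    fun j hj y hy x κ hx _ => sideTouches_of_tower_bond hd2 htower hj hy x κ hx
  -- THE JOIN WITH THE LAWS ON PRINT'S DOMAINS (`hFP_kLevel_of_sectE_local'_RD`, BY NAME) at `k := m + 1`, `Λs := Λs (m+1)`, `B := iηA′`, `αP := α₀`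
  obtain ⟨lam, hlsa, hloff, h108, ⟨μ, hmul⟩, h129''⟩ := hFP_kLevel_of_sectE_local'_RD (k := m + 1) (Λs := Λs (m + 1))
    (Eb := fun j => {b : Site d × Fin d | SideTouches (Ω j) b.1 b.2}) (u₁ := u₁) (A := A') hL hη hU₀ hEbΩ hEbT g Δ q qs Aw c
    g_rightΩ c_range hΔ hqs hq H' hα₀ hα3 hα4 hcB0 hα₄pos hB₀'H hB₂' h33' h69' hd1 hα₀ hα3 hαP2 hBu hP' hAx' h129' hH0 hH1 hH2 hHsupp
    hHequiv hQH hsmall hc₃ hsc hα₃' hs₁ hs₂ hs₃ hs₄ hs₅ hs₆ hs₇ hsm hprod8 hE_def hE₂_def lE_def lE₂_def hBG hBR hcA0 hcA' hcDA0 ha₁' hb₁'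
    hθ hG hGsupp hGreal hRbd hRreal hDA hDAsa hA' hsa h103 h106
  refine ⟨lam, hlsa, hloff, fun j hj b hb => h108 j hj b hb, ⟨μ, fun x hx => ?_⟩, h129''⟩
  -- transport the multiplier clause from `A′` back to `A`: the two agree on the bonds read on `Ω₀`
  have hind : ((Ω 0).indicator fun y => covDivB η U₀ A y + covLap η U₀ lam y +
        ((conjR (gaugeExp lam y)⁻¹ (covDivB η U₀ A y) - covDivB η U₀ A y) +
          (gAd (covLap η U₀ lam y) (lam y) - covLap η U₀ lam y) + ∑ μ, frakF3 η U₀ lam A y μ)) =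
      ((Ω 0).indicator fun y => covDivB η U₀ A' y + covLap η U₀ lam y +
        ((conjR (gaugeExp lam y)⁻¹ (covDivB η U₀ A' y) - covDivB η U₀ A' y) +
          (gAd (covLap η U₀ lam y) (lam y) - covLap η U₀ lam y) + ∑ μ, frakF3 η U₀ lam A' y μ)) := by
    refine Set.indicator_congr fun y hy => ?_
    have h₁ : ∀ ν : Fin d, A' y ν = A y ν := fun ν => hagree 0 (Nat.zero_le _) y ν (sideTouches_pair_of_mem hd2 hy ν).1
    have h₂ : ∀ ν : Fin d, A' (y - e ν) ν = A (y - e ν) ν := fun ν => hagree 0 (Nat.zero_le _) (y - e ν) ν (sideTouches_pair_of_mem hd2 hy ν).2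
    have h₃ : ∀ ν : Fin d, frakF3 η U₀ lam A' y ν = frakF3 η U₀ lam A y ν := fun ν => frakF3_congr_at η U₀ lam (h₁ ν) (h₂ ν)
    simp only [covDivB_congr_at η U₀ h₁ h₂, h₃]
  rw [hind]
  exact hmul x hx
end Body
#print axioms grad_bound_of_datum59_bdryβ
#print axioms sockHFP_body_of_join_59_bdryβ

end Literature.MathematicalPhysics.QuantumFieldTheory.Balaban1983to89.B8SockHFP59BdryBeta

end

/-! ## HONEST SCOPE — VACUOUS AT NESTED MEMBERS AS TYPED (2026-08-27, seat `pub-ymgap-dag-n05-e` g9; director-ym LINE №196, dag-lead DEDUP-349∕350)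

This file is MEMBER-GENERIC: its theorems take a (1.59)-type clause or socket in EDITION β (SCALAR SC2-shape, or the 𝔸-valued `SockB9P3D4β` ∕ `H59Dβ` ∕
four-line bodies) over a datum class `Λb` obeying the law «fine box ⊂ Ω_j» (`hbox`, `ZdIdx.hbox`, `cubeLamB` condition 1).  At every NESTED member with
genuine shells — in particular every cube member of (1.131) with `k ≥ 1` — that law EMPTIES print's crossing bonds of (1.31) at levels `j ≥ 1` and the interior
SHELL GAUGE MODES `∂(𝟙λ)` defeat the clause for ALL constants: there the hypothesis is UNINHABITED and the theorems are VACUOUS AS TYPED — KERNEL CERTIFICATE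
dag-n05-c `B8Ineq159FlatShellModeVacuity` (p572834; ref-E g12 READ-11 A6-FINAL) and `…ShellModeVacuityUniv` (p576185, the lawful `Ω₀ = ℤᵈ` towered member).
No claim is made here about tower-free members.  The theorems stay TRUE and PASS-AS-DECLARED.  Nothing of [Balaban1985RegularSpaces] is refuted: print's class
([B6] (2.3)) contains the crossing bonds and kills the modes (dag-n05-c `B8Ineq159FlatShellModeCrossingDatum`).  SUPERSEDED BY EDITION γ: class dag-n05-c
`cubeLamBP`, socket dag-n06-b `B9SupplySockB9P3ZdGamma`, driver this seat's `B8Eq142KLevelLocalGamma` ∕ `B8Thm4KLevelGamma` (law «box ⊂ Ω_{j−1}»); this file is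
kept as history and for its class-independent mechanics, re-run by token swap in γ.  Count-neutral; N05 NOT discharged; nothing continuum ∕ ℝ⁴ ∕ OS ∕
mass-gap ∕ Clay. -/
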